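import Summits.QuantumFields.BalabanUV.Beta.CombWilsonT2PeriodisedK2

/-!
# `BalabanUV.Beta.CombWilsonT2EvenPairRow` — binder row D1 ∕ (C1), PART 27: **ROAD FP's DISPLAYED WILSON BI-TABLE ROW (J-X₂) IS A THEOREM AT THE SYMMETRIC-BLOCK TABLE — for
# `T := (8N²)⁻¹ • wsym22 N` (`2 ≤ N`) the pair-symmetrised, even-halved, second-slot-periodised torus Wilson bi-table `T₂ b b′ := ½•(Ŵ₂ᵉ(b,b′) + Ŵ₂ᵉ(b′,b))|ff` of
# `FP/TowerHN2Row` IS an2 g42's torus member `H₂^{b,b′}`, so a torus pure gauge in its SECOND index is ONE HALF the commutator of leaf-05's first-order member with the diagonal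
# generator: `Σ_{b′} (Dλ)_{b′} • T₂ b b′ = ½ • (Â_b|ff * E_λ − E_λ * Â_b|ff)`, ANY box, EVERY depth** — `CombWilsonT2PeriodisedK2.torus_H2_pureGauge_snd_fun` read through the even half
# (`wilsonT2_transpose_entry`: the table is leg-symmetric, its even half is itself) and the pair symmetry (`dper_wilsonT2per_swap`)

WHY (journal [AN2-G69-HANDOFF] «SUCCESSOR g70» (4), road FP g45 `FP/TowerHN2Row` v2 p587124 ∕ g46 SPEC-58: v6 keeps (J-X₂) `hX₂` DISPLAYED).  v5∕v6's second-order H-row `hHN₂` is a theorem modulo the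
lock `hcE₂`, the mixed rows and the Wilson bi-table's fine pure-gauge row (J-X₂) `hX₂ : ∀ b λ, Σ_{b′} (Σ_s tgrad T (b′.1, inl b′.2) s · λ s) • T₂ b b′ = ½ • (Â_b|ff * diagonal (λ ·.1) −
diagonal (λ ·.1) * Â_b|ff)`, stated for the FREE position table `Pn.T (n+2)` inside `hT₂`.  At the symmetric-block table the dictionary binds the literal to (`RecursiveWSlot`: `T₂ :=
wilsonW₂ d ((8N²)⁻¹ • wsym22 N)`; JA-TABLE ORDER-2 SLOT RULE) the row is NOT a hypothesis: this file proves it for ANY box `M` (so for every tower torus `towerTorus Lc (fine Lc M) (n+1)`),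
leaving to the instantiation only the one-line pin `Pn.T (n+2) = (8N²)⁻¹ • wsym22 N`.

WHAT (`d = 3`; [folklore] BY NAME over an2 g42's `CombWilsonT2Periodised(K2)`; no `def`, no `def … : Prop`, nothing cited, 0 sorry):
§1 `evenHalf_wilsonT2_eq` — `½•(wilsonW₂ 3 T κ u κ′ u′ + sgnK (trK (wilsonW₂ 3 T κ u κ′ u′))) = wilsonW₂ 3 T κ u κ′ u′` (leg symmetry `wilsonT2_transpose_entry` on `ff`, the other blocks vanish);
§2 **`T2evenPair_eq_member`** — the road's `hT₂` display EQUALS `H₂^{b,b′} := (perF M (dper M (W b′.2 ↑b′.1 b.2 ↑b.1)))|ff` for the K2 file's family `hW : W = fun κ′ u′ κ u x z a c => Σ'_n T₂ κ u κ′ (u′ + M∘n) x z a c`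
(§1 under the copy sum + `dper_wilsonT2per_swap`); **`torus_T2evenPair_pureGauge_snd_fun`** — the road's `hX₂` VERBATIM (box `M`, table `(8N²)⁻¹ • wsym22 N`) as a theorem
(`torus_H2_pureGauge_snd_fun`).
WHAT THIS IS NOT: not the pin `Pn.T (n+2) = (8N²)⁻¹ • wsym22 N` (REFEREE ∕ instantiation); not the lock `hcE₂`; not the mixed rows ((K2b) at depth 1 is PART 25∕26); nothing of Bałaban's
asserted, valued or discharged; 0 estimates; 0∕4 row-D1 binders (hW, hR, D1Tel, D1Rep); ROOT M‴ p325680 ∕ P5c ∕ D6 untouched; NOT (C1), NOT (T-ID), NOT D1, NEVER «G-an2-4 closed», NOT BetaPertH,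
NOT continuum, NOT Clay.

HONEST DEPENDENCY (page 1, mandatory): continuum YM on T⁴ ⇐ BetaPertH ∧ nine spine estimates (0/9 proved); BetaPertH ⇐ (D1) ∧ (D4) ∧ CAP+tail;
G-an2-4 gates asym, D1 and NE2/3/4.  HONEST FRAMING (cell contract, verbatim): «discharging `BetaPertH` makes Bałaban's UV stability UNCONDITIONAL —
a real constructive-QFT result; it is NOT the continuum limit and NOT the Clay problem.»  ABSOLUTE RULE (cell charter, verbatim): «No internally-minted
statement may enter as a cited fact. Every hypothesis is either kernel-proved in this package or a verbatim quotation of a PUBLISHED theorem with page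
reference. The manuscript(s) under audit are NOT citable for their own disputed steps — they are the thing under adjudication; programme-internal
(2001/route/tribunal) claims are never citable.»  Row D1 ∕ (C1) OWNER an2 (b2b-balaban-beta-an2) gen 70, 2026-08-28.  No existing file touched.
-/

noncomputable section

open scoped BigOperators

namespace Summit.QuantumFields.BalabanUV.Beta.CombWilsonT2EvenPairRow

open Finset Matrix
open Literature.MathematicalPhysics.QuantumFieldTheory.Balaban1983to89
open Literature.MathematicalPhysics.QuantumFieldTheory.Balaban1983to89.Beta
open B4TorusKernel.MultiPeriod (translate)
open B6Lemma24Torus (pbox)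
open ExpKernelCalculus (MKer)
open StepJetData (wilsonA)
open WilsonBiStencil (wilsonW₂ wilsonW₂_inl_inr wilsonW₂_inr_inl wilsonW₂_inr_inr)
open WilsonVertex2Sym (wsym22)
open AffineAveraging (Site)
open OneStepResolventKernel (Fib)
open Summit.QuantumFields.BalabanUV.Beta.TameKernelCalculus (trK trK_apply)
open Summit.QuantumFields.BalabanUV.Beta.BorderedHessian (sgnK sgnK_apply sgnF_inl)
open Summit.QuantumFields.BalabanUV.Beta.FP.KernelPeriodisationFib (Idx perF)
open Summit.QuantumFields.BalabanUV.Beta.FP.KernelPeriodisationFibLoc (dper)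
open Summit.QuantumFields.BalabanUV.Beta.FP.TorusGaugeCovariance (tgrad)
open Summit.QuantumFields.BalabanUV.Beta.CombWilsonT2PeriodisedK2 (wilsonT2_transpose_entry dper_wilsonT2per_swap torus_H2_pureGauge_snd_fun)

variable {N : ℕ} (M : Fin (3 + 1) → ℕ) [∀ μ, NeZero (M μ)]

/-! ## §1 The even half of the literal's symmetric-block Wilson bi-stencil is itself -/

omit [∀ μ, NeZero (M μ)] in
/-- [folklore] **`evenHalf_wilsonT2_eq`** — for `T := (8N²)⁻¹ • wsym22 N` the bi-stencil is LEG-SYMMETRIC on the field–field block (`wilsonT2_transpose_entry`) and vanishes off it, so its even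
half `½•(K + sgnK (trK K))` is `K` itself. -/
theorem evenHalf_wilsonT2_eq (κ : Fin (3 + 1)) (u : Site (3 + 1)) (κ' : Fin (3 + 1)) (u' : Site (3 + 1)) :
    (1 / 2 : ℝ) • (wilsonW₂ 3 ((8 * (N : ℝ) ^ 2)⁻¹ • wsym22 N) κ u κ' u' + sgnK (trK (wilsonW₂ 3 ((8 * (N : ℝ) ^ 2)⁻¹ • wsym22 N) κ u κ' u')))
      = wilsonW₂ 3 ((8 * (N : ℝ) ^ 2)⁻¹ • wsym22 N) κ u κ' u' := by
  funext x z a c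
  rw [Pi.smul_apply, Pi.smul_apply, Pi.smul_apply, Pi.smul_apply, smul_eq_mul, Pi.add_apply, Pi.add_apply, Pi.add_apply, Pi.add_apply, sgnK_apply, trK_apply]
  rcases a with α | α <;> rcases c with γ | γ
  · rw [sgnF_inl, sgnF_inl, wilsonT2_transpose_entry (N := N) κ u κ' u' x z (Sum.inl α) (Sum.inl γ)]
    ring
  · rw [wilsonW₂_inl_inr, wilsonW₂_inr_inl]
    ring
  · rw [wilsonW₂_inr_inl, wilsonW₂_inl_inr]
    ring
  · rw [wilsonW₂_inr_inr, wilsonW₂_inr_inr]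
    ring

/-! ## §2 The road's pair-symmetrised even bi-table IS the K2 member; (J-X₂) as a theorem -/

variable {W : Fin (3 + 1) → Site (3 + 1) → Fin (3 + 1) → Site (3 + 1) → MKer (3 + 1) (Fib 3)}
  {T₂ : ↥(pbox M) × Fin (3 + 1) → ↥(pbox M) × Fin (3 + 1) → Matrix (↥(pbox M) × Fin (3 + 1)) (↥(pbox M) × Fin (3 + 1)) ℝ}

/-- [folklore] **`T2evenPair_eq_member` — THE ROAD's `hT₂` DISPLAY IS an2 g42's TORUS MEMBER**: with the K2 file's family `hW : W κ′ u′ κ u := Σ'_n T₂ κ u κ′ (u′ + M∘n)` and the road's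
`hT₂ : T₂ b b′ = ½•((perF M (dper M (Σ'_m ½•(W₂(b; b′+M∘m) + sgnK trK (…)))))|ff + (the same with b ↔ b′))`, `T₂ b b′ = (perF M (dper M (W b′.2 ↑b′.1 b.2 ↑b.1)))|ff`
(§1 under the copy sum; pair symmetry `dper_wilsonT2per_swap`; `½•(H + H) = H`). -/
theorem T2evenPair_eq_member
    (hW : W = fun κ' u' κ u x z a c => ∑' n : Site (3 + 1), wilsonW₂ 3 ((8 * (N : ℝ) ^ 2)⁻¹ • wsym22 N) κ u κ' (translate M u' n) x z a c)
    (hT₂ : ∀ b b' : ↥(pbox M) × Fin (3 + 1), T₂ b b' = (1 / 2 : ℝ) • ((perF M (dper M (fun X Z i₁ i₂ => ∑' m : Site (3 + 1),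
              ((1 / 2 : ℝ) • (wilsonW₂ 3 ((8 * (N : ℝ) ^ 2)⁻¹ • wsym22 N) b.2 (b.1 : Site (3 + 1)) b'.2 (translate M (b'.1 : Site (3 + 1)) m)
                + sgnK (trK (wilsonW₂ 3 ((8 * (N : ℝ) ^ 2)⁻¹ • wsym22 N) b.2 (b.1 : Site (3 + 1)) b'.2 (translate M (b'.1 : Site (3 + 1)) m))))) X Z i₁ i₂))).submatrix
            (fun b : ↥(pbox M) × Fin (3 + 1) => ((b.1, Sum.inl b.2) : Idx M (Fib 3)))
            (fun b : ↥(pbox M) × Fin (3 + 1) => ((b.1, Sum.inl b.2) : Idx M (Fib 3)))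
        + (perF M (dper M (fun X Z i₁ i₂ => ∑' m : Site (3 + 1),
              ((1 / 2 : ℝ) • (wilsonW₂ 3 ((8 * (N : ℝ) ^ 2)⁻¹ • wsym22 N) b'.2 (b'.1 : Site (3 + 1)) b.2 (translate M (b.1 : Site (3 + 1)) m)
                + sgnK (trK (wilsonW₂ 3 ((8 * (N : ℝ) ^ 2)⁻¹ • wsym22 N) b'.2 (b'.1 : Site (3 + 1)) b.2 (translate M (b.1 : Site (3 + 1)) m))))) X Z i₁ i₂))).submatrix
            (fun b : ↥(pbox M) × Fin (3 + 1) => ((b.1, Sum.inl b.2) : Idx M (Fib 3)))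
            (fun b : ↥(pbox M) × Fin (3 + 1) => ((b.1, Sum.inl b.2) : Idx M (Fib 3)))))
    (b b' : ↥(pbox M) × Fin (3 + 1)) :
    T₂ b b' = (perF M (dper M (W b'.2 (b'.1 : Site (3 + 1)) b.2 (b.1 : Site (3 + 1))))).submatrix
        (fun c : ↥(pbox M) × Fin (3 + 1) => ((c.1, Sum.inl c.2) : Idx M (Fib 3)))
        (fun c : ↥(pbox M) × Fin (3 + 1) => ((c.1, Sum.inl c.2) : Idx M (Fib 3))) := by
  have h1 : (fun X Z i₁ i₂ => ∑' m : Site (3 + 1),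
        ((1 / 2 : ℝ) • (wilsonW₂ 3 ((8 * (N : ℝ) ^ 2)⁻¹ • wsym22 N) b.2 (b.1 : Site (3 + 1)) b'.2 (translate M (b'.1 : Site (3 + 1)) m)
          + sgnK (trK (wilsonW₂ 3 ((8 * (N : ℝ) ^ 2)⁻¹ • wsym22 N) b.2 (b.1 : Site (3 + 1)) b'.2 (translate M (b'.1 : Site (3 + 1)) m))))) X Z i₁ i₂)
      = W b'.2 (b'.1 : Site (3 + 1)) b.2 (b.1 : Site (3 + 1)) := by
    rw [hW]
    funext X Z i₁ i₂
    simp only [evenHalf_wilsonT2_eq]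
  have h2 : (fun X Z i₁ i₂ => ∑' m : Site (3 + 1),
        ((1 / 2 : ℝ) • (wilsonW₂ 3 ((8 * (N : ℝ) ^ 2)⁻¹ • wsym22 N) b'.2 (b'.1 : Site (3 + 1)) b.2 (translate M (b.1 : Site (3 + 1)) m)
          + sgnK (trK (wilsonW₂ 3 ((8 * (N : ℝ) ^ 2)⁻¹ • wsym22 N) b'.2 (b'.1 : Site (3 + 1)) b.2 (translate M (b.1 : Site (3 + 1)) m))))) X Z i₁ i₂)
      = W b.2 (b.1 : Site (3 + 1)) b'.2 (b'.1 : Site (3 + 1)) := by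
    rw [hW]
    funext X Z i₁ i₂
    simp only [evenHalf_wilsonT2_eq]
  rw [hT₂, h1, h2, dper_wilsonT2per_swap hW b.2 (b.1 : Site (3 + 1)) b'.2 (b'.1 : Site (3 + 1)), ← two_smul ℝ, smul_smul]
  norm_num

/-- [folklore] **`torus_T2evenPair_pureGauge_snd_fun` — ROAD FP's (J-X₂) `hX₂` AS A THEOREM AT THE SYMMETRIC-BLOCK TABLE** (`2 ≤ N`, ANY box `M`, so every tower torus): for the road's
display `hT₂` (pair-symmetrised, even-halved, second-slot-periodised Wilson bi-table at `T := (8N²)⁻¹ • wsym22 N`), every torus bond `b` and torus gauge function `λ`,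
`Σ_{b′} (Σ_s tgrad M (b′.1, inl b′.2) s · λ s) • T₂ b b′ = ½ • (Â_b|ff * diagonal (λ ·.1) − diagonal (λ ·.1) * Â_b|ff)`, `Â_b := perF M (dper M (wilsonA 3 b.2 ↑b.1))` — the row's
letters VERBATIM (`T2evenPair_eq_member` + `CombWilsonT2PeriodisedK2.torus_H2_pureGauge_snd_fun`). -/
theorem torus_T2evenPair_pureGauge_snd_fun (hN : 2 ≤ N)
    (hT₂ : ∀ b b' : ↥(pbox M) × Fin (3 + 1), T₂ b b' = (1 / 2 : ℝ) • ((perF M (dper M (fun X Z i₁ i₂ => ∑' m : Site (3 + 1),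
              ((1 / 2 : ℝ) • (wilsonW₂ 3 ((8 * (N : ℝ) ^ 2)⁻¹ • wsym22 N) b.2 (b.1 : Site (3 + 1)) b'.2 (translate M (b'.1 : Site (3 + 1)) m)
                + sgnK (trK (wilsonW₂ 3 ((8 * (N : ℝ) ^ 2)⁻¹ • wsym22 N) b.2 (b.1 : Site (3 + 1)) b'.2 (translate M (b'.1 : Site (3 + 1)) m))))) X Z i₁ i₂))).submatrix
            (fun b : ↥(pbox M) × Fin (3 + 1) => ((b.1, Sum.inl b.2) : Idx M (Fib 3)))
            (fun b : ↥(pbox M) × Fin (3 + 1) => ((b.1, Sum.inl b.2) : Idx M (Fib 3)))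
        + (perF M (dper M (fun X Z i₁ i₂ => ∑' m : Site (3 + 1),
              ((1 / 2 : ℝ) • (wilsonW₂ 3 ((8 * (N : ℝ) ^ 2)⁻¹ • wsym22 N) b'.2 (b'.1 : Site (3 + 1)) b.2 (translate M (b.1 : Site (3 + 1)) m)
                + sgnK (trK (wilsonW₂ 3 ((8 * (N : ℝ) ^ 2)⁻¹ • wsym22 N) b'.2 (b'.1 : Site (3 + 1)) b.2 (translate M (b.1 : Site (3 + 1)) m))))) X Z i₁ i₂))).submatrix
            (fun b : ↥(pbox M) × Fin (3 + 1) => ((b.1, Sum.inl b.2) : Idx M (Fib 3)))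
            (fun b : ↥(pbox M) × Fin (3 + 1) => ((b.1, Sum.inl b.2) : Idx M (Fib 3)))))
    (b : ↥(pbox M) × Fin (3 + 1)) (lam : ↥(pbox M) → ℝ) :
    (∑ b' : ↥(pbox M) × Fin (3 + 1), (∑ s : ↥(pbox M), tgrad M (b'.1, Sum.inl b'.2) s * lam s) • T₂ b b')
      = (1 / 2 : ℝ) • ((perF M (dper M (wilsonA 3 b.2 (b.1 : Site (3 + 1))))).submatrix
            (fun c : ↥(pbox M) × Fin (3 + 1) => ((c.1, Sum.inl c.2) : Idx M (Fib 3)))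
            (fun c : ↥(pbox M) × Fin (3 + 1) => ((c.1, Sum.inl c.2) : Idx M (Fib 3)))
          * Matrix.diagonal (fun c : ↥(pbox M) × Fin (3 + 1) => lam c.1)
        - Matrix.diagonal (fun c : ↥(pbox M) × Fin (3 + 1) => lam c.1)
          * (perF M (dper M (wilsonA 3 b.2 (b.1 : Site (3 + 1))))).submatrix
            (fun c : ↥(pbox M) × Fin (3 + 1) => ((c.1, Sum.inl c.2) : Idx M (Fib 3)))
            (fun c : ↥(pbox M) × Fin (3 + 1) => ((c.1, Sum.inl c.2) : Idx M (Fib 3)))) := by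
  set W : Fin (3 + 1) → Site (3 + 1) → Fin (3 + 1) → Site (3 + 1) → MKer (3 + 1) (Fib 3) :=
    fun κ' u' κ u x z a c => ∑' n : Site (3 + 1), wilsonW₂ 3 ((8 * (N : ℝ) ^ 2)⁻¹ • wsym22 N) κ u κ' (translate M u' n) x z a c with hW
  rw [Finset.sum_congr rfl fun b' _ => by rw [T2evenPair_eq_member M hW hT₂ b b']]
  exact torus_H2_pureGauge_snd_fun M hN hW b lam

end Summit.QuantumFields.BalabanUV.Beta.CombWilsonT2EvenPairRow

end
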